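import Summits.ValiantsHypothesis.ValiantsHypothesis.Theorems.LacunarySymmetroidMatrixDescartesCensusDoorA34SheetDecoupledFrame

/-!
# `MatrixDescartes` census — DOOR A at `(3,4)`: the PENCIL OF PLANES THROUGH THE KERNEL LINE of the singular top letter —
# every such plane carries a NINE-nomial (`≤ 8` positive roots) whose sign is FORCED on the definite and on the «minority» phases

HONEST FRAMING.  Object-search cell `pub-symmetroid`, engine seat `val-sym-eng-2` (g10); helper row beside the registered strata line
`Cruxes/DoorA34/Lines/strata.lean` on stmt-ValiantsHypothesis-19980 (`DoorA34 = PosRootLawAt 3 4 18`: OPEN, typed, never asserted here), stubs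
`stub_nullTopCeiling` / `stub_nullNullCeiling` (generic sheet `tr(adj S₃·S₂) ≠ 0`).  Companion of …SheetSemidefBranches (branch law on the frame of the
top letter) and …SheetCoreShadow (no definite 2-frame of the core at a middle-type root).  Here the dual family of compressions: the planes
`W = span(k, y)` THROUGH the kernel line `k` of the singular top letter (`S₃ k = 0`).

* §1 `det_gram_three` — the `3`-frame Gram identity over any commutative ring:
  `det [[kᵀAk, kᵀAy, kᵀAx],[yᵀAk, yᵀAy, yᵀAx],[xᵀAk, xᵀAy, xᵀAx]] = (k·(y × x))²·det A`.
* §2 THE FORCED SIGNS of the plane Gram determinant `Γ_A(k,y) = (kᵀAk)(yᵀAy) − (kᵀAy)²` of a real symmetric `3 × 3` matrix `A`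
  (eigenvalue-free; `Γ_A(k,y) = det(A|span(k,y))` up to a positive factor, and `= (k × y)ᵀ adj A (k × y)` by `gram_det_eq_cross_adjugate`):
  **`gram_det_nonpos_of_negVector`** — `det A < 0`, `kᵀAk < 0` and `A` has a positive vector ⇒ `Γ_A(k,y) ≤ 0` for EVERY `y`
  («a negative vector of a `det < 0`, non-negative-definite symmetric matrix lies in no negative-definite plane»: `k` is a MINORITY vector — inertia
  `(2,1)`, `k` on the negative side — and every plane through it is indefinite or degenerate); the mirror **`gram_det_nonpos_of_posVector`**
  (`0 < det A`, `0 < kᵀAk`, a negative vector); and **`gram_det_nonneg_of_posSemidef`** / **`gram_det_nonneg_of_negSemidef`** (Cauchy–Schwarz: on the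
  definite phases every plane Gram determinant is `≥ 0`).  Proof of the minority law: by §1 the Gram determinant of the frame `(k, y, x)` is
  `(k·(y×x))²·det A ≤ 0`, while it equals `Γ_A(k,y)·xᵀAx − Q` with `Q = (kᵀAk)(yᵀAx)² − 2(kᵀAy)(kᵀAx)(yᵀAx) + (yᵀAy)(kᵀAx)²` and
  `(kᵀAk)·Q = ((kᵀAk)(yᵀAx) − (kᵀAy)(kᵀAx))² + Γ_A(k,y)·(kᵀAx)²`, so `Γ > 0` would force `Q ≤ 0` and a positive Gram determinant.
* §3 THE NINE-NOMIAL.  For a real `(3,4)` pencil `Σ_l X^{d_l} S_l` with `S₃ k = 0` (no symmetry needed) and any `y`, the explicit polynomial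
  `E = Σ_{i<3} Σ_{j<4} C((kᵀS_ik)(yᵀS_jy) − (kᵀS_iy)(yᵀS_jk))·X^{d_i + d_j}` evaluates at every real `t` to `Γ_{F(t)}(k,y)`, `F(t) = Σ_l t^{d_l}S_l`
  (`eval_kernelPlane`), lives on the nine exponents «pair sums of the core ∪ (d₃ + singles)» of …SheetDecoupledFrame (`support_kernelPlane_subset`), and
  so has AT MOST EIGHT distinct positive roots when it is not the zero polynomial (`card_posRoots_kernelPlane_le_eight`; the `X^{2d₃}` monomial of a
  generic `(2,4)` compression is absent because the top letter is rank `≤ 1` on every plane through its kernel).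
* §4 THE SHEET FORM of the forced signs (`kernelPlane_nonpos_of_negVector`, `…_of_posVector`, `kernelPlane_nonneg_of_posSemidef`): along `t`, `E(t) ≥ 0`
  wherever `F(t)` is semidefinite and `E(t) ≤ 0` wherever `k` is a minority vector of `F(t)`; a middle-type det-root of `det F` (the middle eigenvalue
  crossing zero at fixed sign of `kᵀF(t)k = kᵀG(t)k`) switches `k` between minority and majority, an extreme-type root borders a definite phase, and a
  root of the top trinomial `kᵀGk` switches minority/majority without a det-root.  COUNTING READING (paper): between two minority phases of `k` a
  majority phase on which the plane `span(k,y)` becomes definite costs the nine-nomial `E_y` two sign changes — at most four such «lit» phases per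
  plane, for every plane through `k` at once.

LOCATED (this seat, exact rational arithmetic on the tree objects; report DOOR-A34-ENG2G10 §2): on EVERY record object of the sheet — the null-top
seventeens on `(0,1,4,100)` / `(0,1,4,359)`, the semidefinite sixteens, the interleaved sixteen on `(0,4,9,16)`, the null-null fifteen — the level word
is the strict alternation minority/majority along all middle-type roots, NO majority phase is lit for any plane of a Farey grid through `k`, and
`max_y Z₊(E_y) ∈ {2, 3, 4} ≪ 8`: the budget of this file is EXACT BUT SLACK on the record (the objects live in the «dark»/cancellation regime where the
middle eigenvalue's excursions are `10⁻³ … 10⁻¹⁴` of the outer ones).  It is recorded so that no count is built on it alone.  Nothing here bounds any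
count; `DoorA34` and all three stubs stay OPEN; registers unchanged (`ζ_sym(3,4) ∈ {18,19}`); nothing on `MatrixDescartes` (stmt-ValiantsHypothesis-18050)
or `VP ≠ VNP` — VP≠VNP not moved.  [folklore] Gram determinants / Sylvester's law of inertia in explicit `3 × 3` algebra, Cauchy–Schwarz, sparse Descartes
(`Literature.Computability.AlgebraicComplexity.card_roots_toFinset_filter_pos_lt_card_support` via …SheetDecoupledFrame).
-/

-- `Summit.ValiantsHypothesis.ValiantsHypothesis.…` repeats a component by the D-0017 layout
-- (single-conjunct summit), which the `dupNamespace` linter flags; the name is mandated.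
set_option linter.dupNamespace false

namespace Summit.ValiantsHypothesis.ValiantsHypothesis.Theorems.LacunarySymmetroidMatrixDescartes.Census

open scoped BigOperators Matrix Polynomial
open Matrix Polynomial

/-! ## 1. The Gram determinant of a `3`-frame -/

/-- **`3`-frame Gram identity** (any commutative ring, any `3 × 3` matrix `A`, any vectors `k, y, x`): the determinant of the matrix of pairings
`vᵢᵀ A vⱼ` of the frame `(k, y, x)` is `(k·(y × x))² · det A` (it is `det(P A Pᵀ)` for the row matrix `P = [k; y; x]`). [folklore] -/
theorem det_gram_three {R : Type*} [CommRing R] (A : Matrix (Fin 3) (Fin 3) R) (k y x : Fin 3 → R) :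
    Matrix.det !![k ⬝ᵥ (A *ᵥ k), k ⬝ᵥ (A *ᵥ y), k ⬝ᵥ (A *ᵥ x);
                 y ⬝ᵥ (A *ᵥ k), y ⬝ᵥ (A *ᵥ y), y ⬝ᵥ (A *ᵥ x);
                 x ⬝ᵥ (A *ᵥ k), x ⬝ᵥ (A *ᵥ y), x ⬝ᵥ (A *ᵥ x)]
      = (k ⬝ᵥ (y ⨯₃ x)) ^ 2 * A.det := by
  have hP : !![k ⬝ᵥ (A *ᵥ k), k ⬝ᵥ (A *ᵥ y), k ⬝ᵥ (A *ᵥ x);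
                 y ⬝ᵥ (A *ᵥ k), y ⬝ᵥ (A *ᵥ y), y ⬝ᵥ (A *ᵥ x);
                 x ⬝ᵥ (A *ᵥ k), x ⬝ᵥ (A *ᵥ y), x ⬝ᵥ (A *ᵥ x)]
      = Matrix.of ![k, y, x] * A * (Matrix.of ![k, y, x])ᵀ := by
    ext i j
    fin_cases i <;> fin_cases j <;>
      simp [Matrix.mul_apply, dotProduct, Matrix.mulVec, Matrix.vecMul, Fin.sum_univ_three] <;> ring
  rw [hP, Matrix.det_mul, Matrix.det_mul, Matrix.det_transpose, triple_product_eq_det]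
  show _ = (Matrix.det (Matrix.of ![k, y, x])) ^ 2 * A.det
  ring

/-! ## 2. Forced signs of the plane Gram determinant of a real symmetric `3 × 3` matrix -/

/-- Symmetric pairing: `yᵀ A k = kᵀ A y` for symmetric `A`. [folklore] -/
theorem dotProduct_mulVec_symm_comm {A : Matrix (Fin 3) (Fin 3) ℝ} (hA : A.IsSymm) (k y : Fin 3 → ℝ) :
    y ⬝ᵥ (A *ᵥ k) = k ⬝ᵥ (A *ᵥ y) := by
  rw [dotProduct_mulVec, ← Matrix.mulVec_transpose, hA.eq, dotProduct_comm]

/-- **MINORITY LAW (negative side).**  `A` real symmetric `3 × 3` with `det A < 0`, `k` a NEGATIVE vector (`kᵀAk < 0`) and `A` not negative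
semidefinite (some `x` with `0 < xᵀAx`).  Then NO plane through `k` is negative definite: for every `y`, `(kᵀAk)(yᵀAy) − (kᵀAy)² ≤ 0`.
(Inertia reading: `A` has inertia `(2,1)` and `k` lies on the minority side; every plane through `k` meets the positive `2`-space.) [folklore] -/
theorem gram_det_nonpos_of_negVector (A : Matrix (Fin 3) (Fin 3) ℝ) (hA : A.IsSymm) (hdet : A.det < 0)
    (k : Fin 3 → ℝ) (hk : k ⬝ᵥ (A *ᵥ k) < 0) (x : Fin 3 → ℝ) (hx : 0 < x ⬝ᵥ (A *ᵥ x)) (y : Fin 3 → ℝ) :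
    (k ⬝ᵥ (A *ᵥ k)) * (y ⬝ᵥ (A *ᵥ y)) - (k ⬝ᵥ (A *ᵥ y)) ^ 2 ≤ 0 := by
  by_contra hlt
  have hΓ : 0 < (k ⬝ᵥ (A *ᵥ k)) * (y ⬝ᵥ (A *ᵥ y)) - (k ⬝ᵥ (A *ᵥ y)) ^ 2 := not_le.mp hlt
  -- the frame Gram determinant is `(k·(y×x))²·det A ≤ 0`
  have hG := det_gram_three A k y x
  have hnonpos : (k ⬝ᵥ (y ⨯₃ x)) ^ 2 * A.det ≤ 0 := mul_nonpos_of_nonneg_of_nonpos (sq_nonneg _) hdet.le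
  rw [← hG, Matrix.det_fin_three] at hnonpos
  simp only [Matrix.of_apply, Matrix.cons_val', Matrix.cons_val_zero, Matrix.cons_val_one, Matrix.cons_val_two,
    Matrix.empty_val', Matrix.cons_val_fin_one, Matrix.head_cons, Matrix.head_fin_const, Matrix.tail_cons] at hnonpos
  rw [dotProduct_mulVec_symm_comm hA k y, dotProduct_mulVec_symm_comm hA k x, dotProduct_mulVec_symm_comm hA y x] at hnonpos
  -- names for the six pairings
  set a := k ⬝ᵥ (A *ᵥ k) with ha
  set b := k ⬝ᵥ (A *ᵥ y) with hb
  set c := y ⬝ᵥ (A *ᵥ y) with hc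
  set e := k ⬝ᵥ (A *ᵥ x) with he
  set f := y ⬝ᵥ (A *ᵥ x) with hf
  set g := x ⬝ᵥ (A *ᵥ x) with hg
  -- `a·Q = (a f − b e)² + Γ e²` with `Q = a f² − 2 b e f + c e²`, so `Q ≤ 0` (as `a < 0`, `Γ > 0`)
  have hQ : a * f ^ 2 - 2 * b * e * f + c * e ^ 2 ≤ 0 := by
    have hid : a * (a * f ^ 2 - 2 * b * e * f + c * e ^ 2) = (a * f - b * e) ^ 2 + (a * c - b ^ 2) * e ^ 2 := by ring
    have hnn : 0 ≤ (a * f - b * e) ^ 2 + (a * c - b ^ 2) * e ^ 2 := by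
      have : 0 ≤ (a * c - b ^ 2) * e ^ 2 := mul_nonneg hΓ.le (sq_nonneg e)
      nlinarith [sq_nonneg (a * f - b * e)]
    nlinarith
  -- the Gram determinant `= Γ·g − Q ≥ Γ·g > 0`, contradiction
  have hexp : a * (c * g - f * f) - b * (b * g - f * e) + e * (b * f - c * e)
      = (a * c - b ^ 2) * g - (a * f ^ 2 - 2 * b * e * f + c * e ^ 2) := by ring
  nlinarith [mul_pos hΓ hx]

/-- **MINORITY LAW (positive side).**  `0 < det A`, `0 < kᵀAk` and `A` not positive semidefinite (some `x` with `xᵀAx < 0`) ⇒ no plane through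
`k` is positive definite: `(kᵀAk)(yᵀAy) − (kᵀAy)² ≤ 0` for every `y` (`A` has inertia `(1,2)`, `k` on the minority side). [folklore] -/
theorem gram_det_nonpos_of_posVector (A : Matrix (Fin 3) (Fin 3) ℝ) (hA : A.IsSymm) (hdet : 0 < A.det)
    (k : Fin 3 → ℝ) (hk : 0 < k ⬝ᵥ (A *ᵥ k)) (x : Fin 3 → ℝ) (hx : x ⬝ᵥ (A *ᵥ x) < 0) (y : Fin 3 → ℝ) :
    (k ⬝ᵥ (A *ᵥ k)) * (y ⬝ᵥ (A *ᵥ y)) - (k ⬝ᵥ (A *ᵥ y)) ^ 2 ≤ 0 := by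
  have hdet' : (-A).det < 0 := by
    rw [Matrix.det_neg, Fintype.card_fin]; norm_num; exact hdet
  have hk' : k ⬝ᵥ ((-A) *ᵥ k) < 0 := by rw [Matrix.neg_mulVec, dotProduct_neg]; linarith
  have hx' : 0 < x ⬝ᵥ ((-A) *ᵥ x) := by rw [Matrix.neg_mulVec, dotProduct_neg]; linarith
  have h := gram_det_nonpos_of_negVector (-A) hA.neg hdet' k hk' x hx' y
  simp only [Matrix.neg_mulVec, dotProduct_neg] at h
  nlinarith [h]

/-- **DEFINITE PHASE (Cauchy–Schwarz).**  If `A` is positive semidefinite then every plane Gram determinant is `≥ 0`: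
`(kᵀAy)² ≤ (kᵀAk)(yᵀAy)`. [folklore] -/
theorem gram_det_nonneg_of_posSemidef (A : Matrix (Fin 3) (Fin 3) ℝ) (hA : A.PosSemidef) (k y : Fin 3 → ℝ) :
    0 ≤ (k ⬝ᵥ (A *ᵥ k)) * (y ⬝ᵥ (A *ᵥ y)) - (k ⬝ᵥ (A *ᵥ y)) ^ 2 := by
  have hsym : A.IsSymm := hA.1
  have hyk : y ⬝ᵥ (A *ᵥ k) = k ⬝ᵥ (A *ᵥ y) := dotProduct_mulVec_symm_comm hsym k y
  have ha0 : 0 ≤ k ⬝ᵥ (A *ᵥ k) := by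
    have h := hA.dotProduct_mulVec_nonneg k
    rwa [star_trivial] at h
  -- the vector `a•y − b•k` (`a = kᵀAk`, `b = kᵀAy`) has form value `a·(ac − b²) ≥ 0`
  have hv : 0 ≤ (k ⬝ᵥ (A *ᵥ k)) * ((k ⬝ᵥ (A *ᵥ k)) * (y ⬝ᵥ (A *ᵥ y)) - (k ⬝ᵥ (A *ᵥ y)) ^ 2) := by
    have h := hA.dotProduct_mulVec_nonneg ((k ⬝ᵥ (A *ᵥ k)) • y - (k ⬝ᵥ (A *ᵥ y)) • k)
    rw [star_trivial] at h
    have hexp : ((k ⬝ᵥ (A *ᵥ k)) • y - (k ⬝ᵥ (A *ᵥ y)) • k) ⬝ᵥ (A *ᵥ ((k ⬝ᵥ (A *ᵥ k)) • y - (k ⬝ᵥ (A *ᵥ y)) • k))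
        = (k ⬝ᵥ (A *ᵥ k)) * ((k ⬝ᵥ (A *ᵥ k)) * (y ⬝ᵥ (A *ᵥ y)) - (k ⬝ᵥ (A *ᵥ y)) ^ 2) := by
      simp only [Matrix.mulVec_sub, Matrix.mulVec_smul, dotProduct_sub, sub_dotProduct, dotProduct_smul, smul_dotProduct, smul_eq_mul, hyk]
      ring
    rwa [hexp] at h
  -- the vectors `y − s•k`: form value `c − 2 s b + s² a ≥ 0`
  have hs : ∀ s : ℝ, 0 ≤ (y ⬝ᵥ (A *ᵥ y)) - 2 * s * (k ⬝ᵥ (A *ᵥ y)) + s ^ 2 * (k ⬝ᵥ (A *ᵥ k)) := by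
    intro s
    have h := hA.dotProduct_mulVec_nonneg (y - s • k)
    rw [star_trivial] at h
    have hexp : (y - s • k) ⬝ᵥ (A *ᵥ (y - s • k)) = (y ⬝ᵥ (A *ᵥ y)) - 2 * s * (k ⬝ᵥ (A *ᵥ y)) + s ^ 2 * (k ⬝ᵥ (A *ᵥ k)) := by
      simp only [Matrix.mulVec_sub, Matrix.mulVec_smul, dotProduct_sub, sub_dotProduct, dotProduct_smul, smul_dotProduct, smul_eq_mul, hyk]
      ring
    rwa [hexp] at h
  rcases lt_or_eq_of_le ha0 with hapos | hazero
  · -- `a > 0`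
    by_contra hlt
    have : (k ⬝ᵥ (A *ᵥ k)) * ((k ⬝ᵥ (A *ᵥ k)) * (y ⬝ᵥ (A *ᵥ y)) - (k ⬝ᵥ (A *ᵥ y)) ^ 2) < 0 :=
      mul_neg_of_pos_of_neg hapos (not_le.mp hlt)
    linarith
  · -- `a = 0`: then `b = 0`, else `y − s•k` has negative form for a suitable `s`
    have hb0 : k ⬝ᵥ (A *ᵥ y) = 0 := by
      by_contra hbne
      have h1 := hs (((y ⬝ᵥ (A *ᵥ y)) + 1) / (2 * (k ⬝ᵥ (A *ᵥ y))))
      rw [← hazero] at h1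
      have h2 : (y ⬝ᵥ (A *ᵥ y)) - 2 * (((y ⬝ᵥ (A *ᵥ y)) + 1) / (2 * (k ⬝ᵥ (A *ᵥ y)))) * (k ⬝ᵥ (A *ᵥ y))
          + (((y ⬝ᵥ (A *ᵥ y)) + 1) / (2 * (k ⬝ᵥ (A *ᵥ y)))) ^ 2 * 0 = -1 := by
        field_simp; ring
      linarith
    rw [← hazero, hb0]; simp

/-- **DEFINITE PHASE, negative side**: if `−A` is positive semidefinite the plane Gram determinants of `A` are `≥ 0` as well (the form is even in `A`).
[folklore] -/
theorem gram_det_nonneg_of_negSemidef (A : Matrix (Fin 3) (Fin 3) ℝ) (hA : (-A).PosSemidef) (k y : Fin 3 → ℝ) :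
    0 ≤ (k ⬝ᵥ (A *ᵥ k)) * (y ⬝ᵥ (A *ᵥ y)) - (k ⬝ᵥ (A *ᵥ y)) ^ 2 := by
  have h := gram_det_nonneg_of_posSemidef (-A) hA k y
  simp only [Matrix.neg_mulVec, dotProduct_neg] at h
  nlinarith [h]

/-! ## 3. The nine-nomial of a plane through the kernel line of the top letter -/

/-- Bilinear forms of the evaluated pencil, letterwise. [folklore] -/
theorem bilin_eval_pencil_sum {K : ℕ} (d : Fin K → ℕ) (S : Fin K → Matrix (Fin 3) (Fin 3) ℝ) (p q : Fin 3 → ℝ) (t : ℝ) :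
    p ⬝ᵥ ((∑ l, t ^ d l • S l) *ᵥ q) = ∑ l, t ^ d l * (p ⬝ᵥ (S l *ᵥ q)) := by
  simp [Matrix.sum_mulVec, Matrix.smul_mulVec, dotProduct_sum, dotProduct_smul, smul_eq_mul]

/-- **Evaluation**: the explicit polynomial `E = Σ_{i<3} Σ_{j<4} C((kᵀSᵢk)(yᵀSⱼy) − (yᵀSᵢk)(kᵀSⱼy))·X^{dᵢ+dⱼ}` evaluates at `t` to the plane Gram
determinant `(kᵀF k)(yᵀF y) − (kᵀF y)(yᵀF k)` of `F = Σ_l t^{d_l} S_l`, provided the top letter kills `k` (`S₃ k = 0`; no symmetry needed). [folklore] -/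
theorem eval_kernelPlane (d : Fin 4 → ℕ) (S : Fin 4 → Matrix (Fin 3) (Fin 3) ℝ) (k y : Fin 3 → ℝ) (hk : S 3 *ᵥ k = 0) (t : ℝ) :
    (∑ i : Fin 3, ∑ j : Fin 4, C ((k ⬝ᵥ (S (Fin.castSucc i) *ᵥ k)) * (y ⬝ᵥ (S j *ᵥ y)) - (y ⬝ᵥ (S (Fin.castSucc i) *ᵥ k)) * (k ⬝ᵥ (S j *ᵥ y)))
        * (X : ℝ[X]) ^ (d (Fin.castSucc i) + d j)).eval t
      = (k ⬝ᵥ ((∑ l, t ^ d l • S l) *ᵥ k)) * (y ⬝ᵥ ((∑ l, t ^ d l • S l) *ᵥ y))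
        - (k ⬝ᵥ ((∑ l, t ^ d l • S l) *ᵥ y)) * (y ⬝ᵥ ((∑ l, t ^ d l • S l) *ᵥ k)) := by
  have hk' : S (Fin.last 3) *ᵥ k = 0 := hk
  have hkk : k ⬝ᵥ ((∑ l, t ^ d l • S l) *ᵥ k) = ∑ i : Fin 3, t ^ d (Fin.castSucc i) * (k ⬝ᵥ (S (Fin.castSucc i) *ᵥ k)) := by
    rw [bilin_eval_pencil_sum, Fin.sum_univ_castSucc, hk', dotProduct_zero, mul_zero, add_zero]
  have hyk : y ⬝ᵥ ((∑ l, t ^ d l • S l) *ᵥ k) = ∑ i : Fin 3, t ^ d (Fin.castSucc i) * (y ⬝ᵥ (S (Fin.castSucc i) *ᵥ k)) := by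
    rw [bilin_eval_pencil_sum, Fin.sum_univ_castSucc, hk', dotProduct_zero, mul_zero, add_zero]
  rw [hkk, hyk, bilin_eval_pencil_sum d S y y t, bilin_eval_pencil_sum d S k y t]
  simp only [Polynomial.eval_finsetSum, Polynomial.eval_mul, Polynomial.eval_C, Polynomial.eval_pow, Polynomial.eval_X]
  rw [Finset.sum_mul_sum, Finset.sum_mul_sum, Finset.sum_comm (s := (Finset.univ : Finset (Fin 4))), ← Finset.sum_sub_distrib]
  refine Finset.sum_congr rfl fun i _ => ?_
  rw [← Finset.sum_sub_distrib]
  refine Finset.sum_congr rfl fun j _ => ?_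
  rw [pow_add]; ring

/-- **Support**: `E` lives on the nine exponents «pair sums of the core ∪ (d₃ + singles)» (the `X^{2d₃}` monomial of a generic `(2,4)` compression is
absent: the top letter has rank `≤ 1` on every plane through its kernel). [folklore] -/
theorem support_kernelPlane_subset (d : Fin 4 → ℕ) (S : Fin 4 → Matrix (Fin 3) (Fin 3) ℝ) (k y : Fin 3 → ℝ) :
    (∑ i : Fin 3, ∑ j : Fin 4, C ((k ⬝ᵥ (S (Fin.castSucc i) *ᵥ k)) * (y ⬝ᵥ (S j *ᵥ y)) - (y ⬝ᵥ (S (Fin.castSucc i) *ᵥ k)) * (k ⬝ᵥ (S j *ᵥ y)))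
        * (X : ℝ[X]) ^ (d (Fin.castSucc i) + d j)).support
      ⊆ (Finset.univ : Finset (Fin 2 → Fin 3)).image (fun f => ∑ i, d (Fin.castSucc (f i)))
        ∪ (Finset.univ : Finset (Fin 3)).image (fun l => d 3 + d (Fin.castSucc l)) := by
  intro n hn
  by_contra hni
  apply Polynomial.mem_support_iff.mp hn
  rw [Polynomial.finsetSum_coeff]
  refine Finset.sum_eq_zero fun i _ => ?_
  rw [Polynomial.finsetSum_coeff]
  refine Finset.sum_eq_zero fun j _ => ?_
  rw [Polynomial.coeff_C_mul, Polynomial.coeff_X_pow]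
  split_ifs with hnij
  · exfalso
    apply hni
    rcases Fin.eq_castSucc_or_eq_last j with ⟨j', rfl⟩ | rfl
    · refine Finset.mem_union_left _ (Finset.mem_image.mpr ⟨![i, j'], Finset.mem_univ _, ?_⟩)
      rw [Fin.sum_univ_two]
      simpa using hnij.symm
    · refine Finset.mem_union_right _ (Finset.mem_image.mpr ⟨i, Finset.mem_univ _, ?_⟩)
      rw [hnij]; simp [Fin.last]; ring
  · rw [mul_zero]

/-- **At most EIGHT positive roots** for the plane nine-nomial `E` (when it is not the zero polynomial): sparse Descartes on nine monomials. [folklore] -/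
theorem card_posRoots_kernelPlane_le_eight (d : Fin 4 → ℕ) (S : Fin 4 → Matrix (Fin 3) (Fin 3) ℝ) (k y : Fin 3 → ℝ)
    (hE : (∑ i : Fin 3, ∑ j : Fin 4, C ((k ⬝ᵥ (S (Fin.castSucc i) *ᵥ k)) * (y ⬝ᵥ (S j *ᵥ y)) - (y ⬝ᵥ (S (Fin.castSucc i) *ᵥ k)) * (k ⬝ᵥ (S j *ᵥ y)))
        * (X : ℝ[X]) ^ (d (Fin.castSucc i) + d j)) ≠ 0) :
    ((∑ i : Fin 3, ∑ j : Fin 4, C ((k ⬝ᵥ (S (Fin.castSucc i) *ᵥ k)) * (y ⬝ᵥ (S j *ᵥ y)) - (y ⬝ᵥ (S (Fin.castSucc i) *ᵥ k)) * (k ⬝ᵥ (S j *ᵥ y)))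
        * (X : ℝ[X]) ^ (d (Fin.castSucc i) + d j)).roots.toFinset.filter (fun t => 0 < t)).card ≤ 8 :=
  card_posRoots_le_eight_of_support_nine d _ hE (support_kernelPlane_subset d S k y)

/-! ## 4. The sheet form of the forced signs -/

/-- Symmetry of the evaluated pencil. [folklore] -/
theorem isSymm_eval_pencil_four (d : Fin 4 → ℕ) {S : Fin 4 → Matrix (Fin 3) (Fin 3) ℝ} (hS : ∀ l, (S l).IsSymm) (t : ℝ) :
    (∑ l, t ^ d l • S l).IsSymm := by
  unfold Matrix.IsSymm
  rw [Matrix.transpose_sum]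
  exact Finset.sum_congr rfl fun l _ => by rw [Matrix.transpose_smul, hS l]

/-- **MINORITY PHASE, negative side (sheet form).**  Real symmetric `(3,4)` pencil, `S₃ k = 0`, any `y`, any real `t` at which `det F(t) < 0`,
`kᵀF(t)k < 0` and `F(t)` has a positive vector (`k` is a minority vector of `F(t)`): the plane nine-nomial is `≤ 0` at `t`. [folklore] -/
theorem kernelPlane_nonpos_of_negVector (d : Fin 4 → ℕ) (S : Fin 4 → Matrix (Fin 3) (Fin 3) ℝ) (hS : ∀ l, (S l).IsSymm)
    (k : Fin 3 → ℝ) (hk : S 3 *ᵥ k = 0) (y : Fin 3 → ℝ) (t : ℝ)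
    (hdet : (∑ l, t ^ d l • S l).det < 0) (hneg : k ⬝ᵥ ((∑ l, t ^ d l • S l) *ᵥ k) < 0)
    (x : Fin 3 → ℝ) (hx : 0 < x ⬝ᵥ ((∑ l, t ^ d l • S l) *ᵥ x)) :
    (∑ i : Fin 3, ∑ j : Fin 4, C ((k ⬝ᵥ (S (Fin.castSucc i) *ᵥ k)) * (y ⬝ᵥ (S j *ᵥ y)) - (y ⬝ᵥ (S (Fin.castSucc i) *ᵥ k)) * (k ⬝ᵥ (S j *ᵥ y)))
        * (X : ℝ[X]) ^ (d (Fin.castSucc i) + d j)).eval t ≤ 0 := by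
  rw [eval_kernelPlane d S k y hk t, dotProduct_mulVec_symm_comm (isSymm_eval_pencil_four d hS t) k y, ← sq]
  exact gram_det_nonpos_of_negVector _ (isSymm_eval_pencil_four d hS t) hdet k hneg x hx y

/-- **MINORITY PHASE, positive side (sheet form)**: `0 < det F(t)`, `0 < kᵀF(t)k`, a negative vector ⇒ the plane nine-nomial is `≤ 0` at `t`. [folklore] -/
theorem kernelPlane_nonpos_of_posVector (d : Fin 4 → ℕ) (S : Fin 4 → Matrix (Fin 3) (Fin 3) ℝ) (hS : ∀ l, (S l).IsSymm)
    (k : Fin 3 → ℝ) (hk : S 3 *ᵥ k = 0) (y : Fin 3 → ℝ) (t : ℝ)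
    (hdet : 0 < (∑ l, t ^ d l • S l).det) (hpos : 0 < k ⬝ᵥ ((∑ l, t ^ d l • S l) *ᵥ k))
    (x : Fin 3 → ℝ) (hx : x ⬝ᵥ ((∑ l, t ^ d l • S l) *ᵥ x) < 0) :
    (∑ i : Fin 3, ∑ j : Fin 4, C ((k ⬝ᵥ (S (Fin.castSucc i) *ᵥ k)) * (y ⬝ᵥ (S j *ᵥ y)) - (y ⬝ᵥ (S (Fin.castSucc i) *ᵥ k)) * (k ⬝ᵥ (S j *ᵥ y)))
        * (X : ℝ[X]) ^ (d (Fin.castSucc i) + d j)).eval t ≤ 0 := by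
  rw [eval_kernelPlane d S k y hk t, dotProduct_mulVec_symm_comm (isSymm_eval_pencil_four d hS t) k y, ← sq]
  exact gram_det_nonpos_of_posVector _ (isSymm_eval_pencil_four d hS t) hdet k hpos x hx y

/-- **DEFINITE PHASE (sheet form)**: where `F(t)` is positive semidefinite the plane nine-nomial is `≥ 0`. [folklore] -/
theorem kernelPlane_nonneg_of_posSemidef (d : Fin 4 → ℕ) (S : Fin 4 → Matrix (Fin 3) (Fin 3) ℝ) (hS : ∀ l, (S l).IsSymm)
    (k : Fin 3 → ℝ) (hk : S 3 *ᵥ k = 0) (y : Fin 3 → ℝ) (t : ℝ) (hpsd : (∑ l, t ^ d l • S l).PosSemidef) :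
    0 ≤ (∑ i : Fin 3, ∑ j : Fin 4, C ((k ⬝ᵥ (S (Fin.castSucc i) *ᵥ k)) * (y ⬝ᵥ (S j *ᵥ y)) - (y ⬝ᵥ (S (Fin.castSucc i) *ᵥ k)) * (k ⬝ᵥ (S j *ᵥ y)))
        * (X : ℝ[X]) ^ (d (Fin.castSucc i) + d j)).eval t := by
  rw [eval_kernelPlane d S k y hk t, dotProduct_mulVec_symm_comm (isSymm_eval_pencil_four d hS t) k y, ← sq]
  exact gram_det_nonneg_of_posSemidef _ hpsd k y

/-- **DEFINITE PHASE, negative side (sheet form)**: where `−F(t)` is positive semidefinite the plane nine-nomial is `≥ 0`. [folklore] -/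
theorem kernelPlane_nonneg_of_negSemidef (d : Fin 4 → ℕ) (S : Fin 4 → Matrix (Fin 3) (Fin 3) ℝ) (hS : ∀ l, (S l).IsSymm)
    (k : Fin 3 → ℝ) (hk : S 3 *ᵥ k = 0) (y : Fin 3 → ℝ) (t : ℝ) (hnsd : (-(∑ l, t ^ d l • S l)).PosSemidef) :
    0 ≤ (∑ i : Fin 3, ∑ j : Fin 4, C ((k ⬝ᵥ (S (Fin.castSucc i) *ᵥ k)) * (y ⬝ᵥ (S j *ᵥ y)) - (y ⬝ᵥ (S (Fin.castSucc i) *ᵥ k)) * (k ⬝ᵥ (S j *ᵥ y)))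
        * (X : ℝ[X]) ^ (d (Fin.castSucc i) + d j)).eval t := by
  rw [eval_kernelPlane d S k y hk t, dotProduct_mulVec_symm_comm (isSymm_eval_pencil_four d hS t) k y, ← sq]
  exact gram_det_nonneg_of_negSemidef _ hnsd k y

end Summit.ValiantsHypothesis.ValiantsHypothesis.Theorems.LacunarySymmetroidMatrixDescartes.Census
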